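import Summits.BirchSwinnertonDyer.BirchSwinnertonDyer.Theorems.AdditiveKolyvaginRoadToricIsotropy
import Summits.BirchSwinnertonDyer.BirchSwinnertonDyer.Theorems.AdditiveKolyvaginRoadRankLoweringReduction
import Summits.BirchSwinnertonDyer.BirchSwinnertonDyer.Theorems.KolyvaginRoadThreeMethod2Iso
import HarnessLib

/-!
# Route `AdditiveKolyvaginRoad`, crux `KolyvaginPrimitiveAdditive` (item stmt-BirchSwinnertonDyer-20132):
# stub A1 `stub_rankLoweringAdditive` — the input (Iso) (Poitou–Tate see-saw, W. Zhang Prop. 5.4) DISCHARGED at a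
# general prime `p`, and the stub from (Cheb) + (Equiv) alone
# (cell `pub/bsd-wall`, lead prover `bsd-wall-akr-p1` g2; `--supports stmt-BirchSwinnertonDyer-20132`, helper;
# p-generic port of koly g13's `Theorems/KolyvaginRoadThreeMethod2Iso.lean`, ordinary ↦ TORIC)

WHY THIS FILE. akr-p1 g0's `AdditiveKoly.selQP_rankLowering_of_localGlobal` (p511644) proves the (A1) body of the
registered stub `stub_rankLoweringAdditive` of crux 20132 from five inputs at Bertolini–Darmon admissible primes:
(Cheb), (Equiv), (Line), (Trans), (Iso). (Line) and (Trans) are kernel theorems of the sibling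
`AdditiveKolyvaginRoadLocalFrobenius` (akr-p1 g2). Here (Iso) — the one GLOBAL input — is PROVED at an imaginary
quadratic `K`, using only PROVED tree theorems (koly g13's `…Method2IsoLocalDuality.lean`: Tate's reciprocity law for
the totally complex `K`, local Tate duality for `E[p]`, the prime-to-`p` Euler characteristic; the discharged Kummer
isotropy; and the toric inputs of the sibling `AdditiveKolyvaginRoadToricIsotropy`):
* `hiso_of_admQ` — (Iso) VERBATIM (p511644's binder: `SelRelQP W K p c (insert q n) {q} μ` at the place of the
  BD-admissible `q ∉ n`, `torsionLocMap` model). Proof: for `y, z` in the relaxed space the local Weil terms vanish at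
  every place `w ≠ v_q` — Kummer isotropy at the infinite places and at the finite places below no level prime, TORIC
  isotropy `e(L, L) = 0` at the places of `n` (`L = (F − 1)E[p]` of order `≤ p`; the place of `q` is `v_q`, `q`
  being inert) — so by Poitou–Tate the image at `v_q` is isotropic in `H¹(K_{v_q}, E[p])`, of order `≤ p²` by
  (H0)_p (`natCard_invariants_le_of_admQ`), hence a line;
* `stub_rankLoweringAdditive_of_cheb_equiv` — THE REGISTERED SIGNATURE of A1 (skeleton v5, sha16 de262348) VERBATIM
  ⟸ frame-wise (Cheb) ∧ (Equiv) (p511644's `selQP_rankLowering_of_localGlobal` fed with `localLine_of_admQ`,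
  `localTrans_of_admQ`, `hiso_of_admQ`).
NET: of the five inputs of A1, (Line), (Trans), (Iso) are now in the kernel at every prime `p ≥ 5`; what remains is
(Equiv) [the sign `ε_q` of complex conjugation on `H¹(K_q, E[p])`, W. Zhang (9.2)] and (Cheb) [Čebotarev with the
sign, W. Zhang Lemma 7.3 ∕ Bertolini–Darmon Thm. 3.2].

HONEST FRAMING: theorems only; no definition, no named fact, no `sorry`; the stub is NOT proved ((Cheb), (Equiv)
remain hypotheses); nothing is booked.

References: [cite: WZhang2014, Prop. 5.4, Lemma 7.3, §9 (9.1)–(9.3)] [cite: BertoliniDarmon2005, Lemma 2.6, §2.2–§2.3,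
Thm. 3.2] [cite: MilneADT2006, Ch. I, Cor. 2.3, Thm. 2.8, Thm. 4.10(b)] [cite: PoonenRains2012, Prop. 4.8, Cor. 4.6].
-/

-- single-conjunct summit: `Summit.BirchSwinnertonDyer.BirchSwinnertonDyer.…` repeats the name by design
set_option linter.dupNamespace false

noncomputable section

open scoped Classical

namespace Summit.BirchSwinnertonDyer.BirchSwinnertonDyer.Theorems.AdditiveKoly

open CategoryTheory WeierstrassCurve Field Function NumberField IsDedekindDomain
open Literature.NumberTheory.EllipticCurves Literature.NumberTheory.EllipticCurves.ModularForms
  Literature.NumberTheory.GaloisRepresentations Module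
open Literature.NumberTheory.GaloisRepresentations.DiscreteGaloisModule (mu MuCarrier)
open Literature.NumberTheory.GaloisCohomology
open Summit.BirchSwinnertonDyer.Rank1Residual.X11b.Three.Koly.Method2
open scoped ContRepresentation

/-! ## §1 (Iso) at a general prime `p` -/

section Iso

variable (W : WeierstrassCurve ℚ) (K : Type) [Field K] [NumberField K] (p : ℕ) (c : K ≃ₐ[ℚ] K)
variable [W.IsElliptic] [W.IsGloballyMinimal] [Fact p.Prime] [Module (ZMod p) (Vp W K p)]

/-- **(Iso) at a general prime.** The input (Iso) of `AdditiveKoly.selQP_rankLowering_of_localGlobal` ∕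
`stub_rankLoweringAdditive_of_localGlobal` (akr-p1 g0, p511644) VERBATIM — at a Bertolini–Darmon admissible `q ∉ n`
with place `v`, the `torsionLocMap`-localisations at `v` of two classes of the `q`-relaxed space
`SelRelQP (insert q n) {q} μ` are proportional — for `K` imaginary quadratic. Proof (W. Zhang Prop. 5.4; koly MEMO-v8
§5 at `p = 3`, ported): the local Weil terms of two classes of the relaxed space vanish at every place `w ≠ v` (Kummer
isotropy at the infinite places and at the finite places under no level prime; toric isotropy `e(L, L) = 0` at the
places of `n`, `#L ≤ p` by `natCard_augmentation_le_of_admQ`; the place of the inert `q` is `v`), so by Tate's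
reciprocity law for the totally complex `K` (`Iso.exists_zsmul_localization_of_forall_ne`) the image at `v` is
isotropic in `H¹(K_v, E[p])`, which has order `≤ p²` by (H0)_p (`natCard_invariants_le_of_admQ`,
`Iso.natCard_galoisCohomology_one_torsion_le_sq`), hence is a line; transported to the `torsionLocMap` model by
`Iso.exists_addMonoidHom_comp_localization_eq_torsionLocMap`. [cite: WZhang2014, Prop. 5.4, §9 (9.1)–(9.2)]
[cite: MilneADT2006, Ch. I, Thm. 4.10(b)] [cite: BertoliniDarmon2005, §2.3] -/
theorem hiso_of_admQ (hK : IsImaginaryQuadratic K) :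
    ∀ (n : Finset (AdmQ W K p)) (q : AdmQ W K p) (μ : Bool),
      q ∉ n → ∀ v : HeightOneSpectrum (𝓞 K), ((q : ℕ) : 𝓞 K) ∈ v.asIdeal →
      ∀ y ∈ SelRelQP W K p c (insert q n) {q} μ, ∀ z ∈ SelRelQP W K p c (insert q n) {q} μ,
        (W.baseChange K).torsionLocMap (v.adicCompletion K) ((p ^ 1 : ℕ) : ℤ) z ≠ 0 →
        ∃ a : ℤ, (W.baseChange K).torsionLocMap (v.adicCompletion K) ((p ^ 1 : ℕ) : ℤ) y =
          a • (W.baseChange K).torsionLocMap (v.adicCompletion K) ((p ^ 1 : ℕ) : ℤ) z := by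
  intro n q μ hqn v hv y hy z hz hz0
  have hp : p.Prime := Fact.out
  haveI : IsTotallyComplex K := hK.2
  haveI : Fact (Nat.Prime (p ^ 1)) := ⟨by rw [pow_one]; exact hp⟩
  haveI : PerfectField K := PerfectField.ofCharZero
  -- cup products need `LocallyCompactSpace Γ` (compactness of absolute Galois groups) and `E[p]` finite (Tate dual);
  -- local instances in the tree's cup-product files, supplied here inside the proof
  haveI hcs : ∀ (L : Type) [Field L], CompactSpace (absoluteGaloisGroup L) :=
    fun L _ ↦ @absoluteGaloisGroup_compactSpace L _
  haveI : Finite (geomTorsion (W.baseChange K) ((p ^ 1 : ℕ) : ℤ)) :=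
    finite_geomTorsion_of_neZero (W.baseChange K) (p ^ 1)
  have hpZ : ((p ^ 1 : ℕ) : ℤ) ≠ 0 := by exact_mod_cast pow_ne_zero 1 hp.ne_zero
  obtain ⟨e, hμ, hadd₁, hadd₂, halt, hnondeg, hgal⟩ :=
    exists_weilPairing_holds (W.baseChange K) (p ^ 1) (by rw [pow_one]; exact hp.two_le) (by
      rw [pow_one]; exact_mod_cast hp.ne_zero)
  -- the place above the inert prime `q` is unique
  have hq0 : (q : ℕ) ≠ 0 := q.2.1.ne_zero
  have hqP : (Ideal.span {((q : ℕ) : 𝓞 K)}).IsPrime := q.2.2.2.1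
  have huniq : ∀ w : HeightOneSpectrum (𝓞 K), ((q : ℕ) : 𝓞 K) ∈ w.asIdeal → w = v :=
    fun w hw ↦ placesAbove_eq_of_isPrime_span K hqP hq0 hv hw
  -- `v ∤ p`
  have hpv : ((p ^ 1 : ℕ) : 𝓞 K) ∉ v.asIdeal := by
    have h := (hasGoodReductionAt_of_isAdmissiblePrime W K q.2 v hv).2
    rw [Int.cast_natCast] at h
    rw [Nat.pow_one]
    exact h
  -- `#H¹(K_v, E[p]) ≤ p²`
  have hcard := Iso.natCard_galoisCohomology_one_torsion_le_sq (W.baseChange K) (p ^ 1) v hpv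
    (natCard_invariants_le_of_admQ W K p hK.1 q v hv)
  -- the comparison `Φ ∘ loc_v = torsionLocMap` between the two models of `H¹(K_v, E[p])`
  obtain ⟨Φ, hΦ⟩ := Iso.exists_addMonoidHom_comp_localization_eq_torsionLocMap (W.baseChange K) (p ^ 1) v
  -- membership in the relaxed level-raised space, unpacked
  have hmem : ∀ x ∈ SelRelQP W K p c (insert q n) {q} μ,
      (∀ w : InfinitePlace K,
        x ∈ selmerLocalKer (W.baseChange K) w.Completion ((p ^ 1 : ℕ) : ℤ)) ∧
      (∀ w : HeightOneSpectrum (𝓞 K), (∀ q' ∈ insert q n, ((q' : ℕ) : 𝓞 K) ∉ w.asIdeal) →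
        x ∈ selmerLocalKer (W.baseChange K) (w.adicCompletion K) ((p ^ 1 : ℕ) : ℤ)) ∧
      (∀ q' ∈ n, ∀ w : HeightOneSpectrum (𝓞 K), ((q' : ℕ) : 𝓞 K) ∈ w.asIdeal →
        x ∈ toricLocalKer (W.baseChange K) (w.adicCompletion K) ((p ^ 1 : ℕ) : ℤ)) := by
    intro x hx
    change x ∈ levelSelmerSubgroupP W K p c _ _ μ at hx
    simp only [levelSelmerSubgroupP, AddSubgroup.mem_inf, AddSubgroup.mem_iInf] at hx
    obtain ⟨-, hinf, hfin, hord⟩ := hx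
    refine ⟨hinf, fun w hw ↦ hfin w fun q'' hq'' ↦ ?_, fun q' hq' w hw ↦ hord q' ⟨?_, ?_⟩ w hw⟩
    · rcases hq'' with hq'' | hq''
      · rw [Finset.mem_coe, Finset.mem_image] at hq''
        obtain ⟨a, ha, rfl⟩ := hq''
        exact hw a ha
      · obtain ⟨a, ha, rfl⟩ := hq''
        rw [Set.mem_singleton_iff] at ha
        subst ha
        exact hw a (Finset.mem_insert_self _ _)
    · exact Finset.mem_image.mpr ⟨q', Finset.mem_insert_of_mem hq', rfl⟩
    · rintro ⟨a, ha, haq⟩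
      rw [Set.mem_singleton_iff] at ha
      subst ha
      exact hqn (Subtype.ext haq ▸ hq')
  -- the local Weil terms of two classes of the relaxed space vanish at every place `w ≠ v`
  have hA : ∀ y ∈ (SelRelQP W K p c (insert q n) {q} μ).toAddSubgroup,
      ∀ z ∈ (SelRelQP W K p c (insert q n) {q} μ).toAddSubgroup, ∀ w : Place K, w ≠ Sum.inr v →
      (weilContPairingLocal (W.baseChange K) (p ^ 1) e hμ hadd₁ hadd₂ hgal w).cupProduct
        (galoisCohomology.localization ((W.baseChange K).torsionGaloisModule ((p ^ 1 : ℕ) : ℤ)) w 1 y)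
        (galoisCohomology.localization ((W.baseChange K).torsionGaloisModule ((p ^ 1 : ℕ) : ℤ)) w 1 z)
        = 0 := by
    intro y hy z hz w hw
    obtain ⟨hyinf, hyfin, hyord⟩ := hmem y hy
    obtain ⟨hzinf, hzfin, hzord⟩ := hmem z hz
    -- Kummer isotropy at a place where both classes satisfy the Kummer condition
    have hKum : ∀ w : Place K,
        y ∈ selmerLocalKer (W.baseChange K) (Place.Completion w) ((p ^ 1 : ℕ) : ℤ) →
        z ∈ selmerLocalKer (W.baseChange K) (Place.Completion w) ((p ^ 1 : ℕ) : ℤ) →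
        (weilContPairingLocal (W.baseChange K) (p ^ 1) e hμ hadd₁ hadd₂ hgal w).cupProduct
          (galoisCohomology.localization ((W.baseChange K).torsionGaloisModule ((p ^ 1 : ℕ) : ℤ)) w 1 y)
          (galoisCohomology.localization ((W.baseChange K).torsionGaloisModule ((p ^ 1 : ℕ) : ℤ)) w 1 z)
          = 0 := by
      intro w hyw hzw
      rw [← comap_localization_kummerSelmerStructure] at hyw hzw
      exact (W.baseChange K).cupProduct_eq_zero_of_mem_kummerSelmerStructure_of_fact (p ^ 1) e hpZ w
        (kummerClass_cupProduct_kummerClass_eq_zero_holds _) hμ hadd₁ hadd₂ halt hgal hyw hzw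
    rcases w with w | w
    · -- infinite place: Kummer on both sides
      exact hKum (Sum.inl w) (hyinf w) (hzinf w)
    · have hwv : w ≠ v := fun h ↦ hw (by rw [h])
      by_cases hex : ∃ q' ∈ insert q n, ((q' : ℕ) : 𝓞 K) ∈ w.asIdeal
      · -- a level prime below `w`: it is in `n` (the place of `q` is `v`), both classes are toric
        obtain ⟨q', hq', hq'w⟩ := hex
        rcases Finset.mem_insert.mp hq' with rfl | hq'n
        · exact absurd (huniq w hq'w) hwv
        · exact weilCupProduct_res_eq_zero_of_valued (W.baseChange K) (p ^ 1) (w.adicCompletion K)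
            e hμ hadd₁ hadd₂ hgal _
            (fun S hS T hT ↦ weilPairingHom_eq_zero_of_mem_of_card_le (W.baseChange K) (p ^ 1)
              e hμ hadd₁ hadd₂ halt _ (natCard_augmentation_le_of_admQ W K p hK.1 q' w hq'w) S T hS hT)
            (exists_valued_cocycle_of_mem_toricLocalKer (W.baseChange K) (p ^ 1) (w.adicCompletion K)
              (hyord q' hq'n w hq'w))
            (exists_valued_cocycle_of_mem_toricLocalKer (W.baseChange K) (p ^ 1) (w.adicCompletion K)
              (hzord q' hq'n w hq'w))
      · -- no level prime below `w`: Kummer on both sides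
        push Not at hex
        exact hKum (Sum.inr w) (hyfin w hex) (hzfin w hex)
  -- Poitou–Tate at `v`
  have hz0' : galoisCohomology.localization ((W.baseChange K).torsionGaloisModule ((p ^ 1 : ℕ) : ℤ))
      (Sum.inr v) 1 z ≠ 0 := fun h ↦ hz0 (by rw [← hΦ z, h]; exact map_zero Φ)
  obtain ⟨a, ha⟩ := Iso.exists_zsmul_localization_of_forall_ne (W.baseChange K) (p ^ 1) e hμ hadd₁ hadd₂ hgal
    v hnondeg hcard (SelRelQP W K p c (insert q n) {q} μ).toAddSubgroup hA hy hz hz0'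
  exact ⟨a, by rw [← hΦ y, ← hΦ z, ha]; exact map_zsmul Φ a _⟩

end Iso

/-! ## §2 The registered stub A1 from (Cheb) + (Equiv) alone -/

section Stub

open Literature.NumberTheory.EllipticCurves.Rank1Residual

/-- **`stub_rankLoweringAdditive` (skeleton v5 of crux 20132) FROM (Cheb) + (Equiv) ALONE, frame-wise** — the
registered signature VERBATIM as conclusion. At each ♯ additive frame and each `c ≠ 1`, GIVEN (Cheb) [a non-zero class
of `SelQP n μ` is detected at some BD-admissible `q ∉ n`: W. Zhang Lemma 7.3 ∕ Bertolini–Darmon Thm. 3.2] and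
(Equiv) [complex conjugation acts on `H¹(K_q, E[p])` by a scalar sign, `loc_q` equivariantly: W. Zhang (9.2)] for
that `(E, K, p, c)` (binder `hCE`, which receives the whole frame), the (A1) rank lowering holds: akr-p1 g0's
`selQP_rankLowering_of_localGlobal` fed with the kernel theorems `localLine_of_admQ`, `localTrans_of_admQ` (sibling
`AdditiveKolyvaginRoadLocalFrobenius`) and `hiso_of_admQ` (§1); `[K : ℚ] = 2` and total complexity come from the
frame's `IsImaginaryQuadratic K`, `p` is odd since `5 ≤ p`. CONDITIONAL on `hCE`; the stub is proved once (Cheb) and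
(Equiv) are discharged. [cite: WZhang2014, Prop. 5.4, Lemma 7.3, §9 (9.1)–(9.3)]
[cite: BertoliniDarmon2005, Lemma 2.6, Thm. 3.2] -/
theorem stub_rankLoweringAdditive_of_cheb_equiv
    (hCE : ∀ (W : WeierstrassCurve ℚ) [W.IsElliptic] [W.IsGloballyMinimal] [NeZero (W.conductorNorm ℤ)]
      (p : ℕ) [Fact p.Prime] (K : Type) [Field K] [NumberField K] (c : K ≃ₐ[ℚ] K) [Module (ZMod p) (Vp W K p)],
      5 ≤ p → Addv W p → W.HasSurjectiveModNGaloisRep p → IsImaginaryQuadratic K → Odd (NumberField.discr K) →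
      SatisfiesHeegnerHypothesis (W.conductorNorm ℤ) K → c ≠ 1 →
      -- (Cheb)
      (∀ (n : Finset (AdmQ W K p)) (μ : Bool) (x : Vp W K p), x ∈ SelQP W K p c n μ → x ≠ 0 →
        ∃ q : AdmQ W K p, q ∉ n ∧ ∃ v : HeightOneSpectrum (𝓞 K),
          ((q : ℕ) : 𝓞 K) ∈ v.asIdeal ∧ (W.baseChange K).torsionLocMap (v.adicCompletion K) ((p ^ 1 : ℕ) : ℤ) x ≠ 0) ∧
      -- (Equiv)
      (∀ q : AdmQ W K p, ∃ s : Bool, ∀ v : HeightOneSpectrum (𝓞 K),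
        ((q : ℕ) : 𝓞 K) ∈ v.asIdeal → ∀ z : Vp W K p,
          (W.baseChange K).torsionLocMap (v.adicCompletion K) ((p ^ 1 : ℕ) : ℤ) (conjAct W c ((p ^ 1 : ℕ) : ℤ) z) =
            sgnP s • (W.baseChange K).torsionLocMap (v.adicCompletion K) ((p ^ 1 : ℕ) : ℤ) z)) :
    ∀ (W : WeierstrassCurve ℚ) [W.IsElliptic] [W.IsGloballyMinimal] [NeZero (W.conductorNorm ℤ)]
      (p : ℕ) [Fact p.Prime] (K : Type) [Field K] [NumberField K]
      (Dt : ModularParametrizationData W (W.conductorNorm ℤ)) (β : ℤ) (ι : K →+* ℂ),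
      5 ≤ p → Addv W p → W.HasSurjectiveModNGaloisRep p →
      (∀ (ℓ : ℕ) [Fact ℓ.Prime], W.HasMultiplicativeReductionAtPrime ℓ →
        ¬ p ∣ padicValInt ℓ W.minimalDiscriminantInt) →
      (∃ (ℓ₁ ℓ₂ : ℕ) (_ : Fact ℓ₁.Prime) (_ : Fact ℓ₂.Prime), ℓ₁ ≠ ℓ₂ ∧
        W.HasMultiplicativeReductionAtPrime ℓ₁ ∧ W.HasMultiplicativeReductionAtPrime ℓ₂) →
      ¬ p ∣ W.tamagawaProduct → W.analyticRank = 1 →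
      IsImaginaryQuadratic K → Odd (NumberField.discr K) →
      SatisfiesHeegnerHypothesis (W.conductorNorm ℤ) K →
      (W.quadraticTwist (NumberField.discr K : ℚ)).entireLFunction 1 ≠ 0 →
      (4 * (W.conductorNorm ℤ : ℤ)) ∣ β ^ 2 - NumberField.discr K → ¬ (p : ℤ) ∣ Dt.c →
      ∀ (c : K ≃ₐ[ℚ] K), c ≠ 1 → ∀ [Module (ZMod p) (Vp W K p)],
        (∀ (n : Finset (AdmQ W K p)) (μ : Bool) (x : Vp W K p),
          x ∈ SelQP W K p c n μ → x ≠ 0 →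
          ∃ q : AdmQ W K p, q ∉ n ∧
            x ∉ SelQP W K p c (insert q n) μ ∧
            SelQP W K p c (insert q n) μ ≤ SelQP W K p c n μ ∧
            finrank (ZMod p) (SelQP W K p c (insert q n) μ) + 1 = finrank (ZMod p) (SelQP W K p c n μ) ∧
            SelQP W K p c (insert q n) (!μ) = SelQP W K p c n (!μ)) := by
  intro W _ _ _ p _ K _ _ Dt β ι h5 hadd hsurj _ _ _ _ hK hodd hH _ _ _ c hc1 _
  have hp : Odd p := (Fact.out : p.Prime).odd_of_ne_two (by omega)
  obtain ⟨hcheb, hequiv⟩ := hCE W p K c h5 hadd hsurj hK hodd hH hc1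
  exact selQP_rankLowering_of_localGlobal W K p c hp hcheb hequiv (localLine_of_admQ W K p hK.1)
    (localTrans_of_admQ W K p) (hiso_of_admQ W K p c hK)

end Stub

end Summit.BirchSwinnertonDyer.BirchSwinnertonDyer.Theorems.AdditiveKoly

end
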